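import Summits.QuantumFields.BalabanUV.Beta.GAN24.WilsonSectorRate
import Summits.QuantumFields.BalabanUV.Beta.GAN24.ContactCauchyAssemblyHolds

/-!
# `BalabanUV.Beta.GAN24.WilsonSectorRateHolds` — binder row G-an2-4 / (CONV-C), the row owner's CONTACT-TERM ROUTE, **CT-4e FOR THE WILSON SECTOR, UNCONDITIONAL**:
# hSdev — the all-scales Cauchy letter `∀ k j, LocStencil (unitS_{k+j}(wilsonSecAt_{k+j}) − unitS_k(wilsonSecAt_k)) (cS·θS^k) δS` at SOME `θS < 1` — for the
# cubic-WILSON sector of the recursive comb family (E), for every `Lc ≥ 2` at the pin `cE = Lc^4`, every in-block root: part 3's conditional assembly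
# `WilsonSectorRate.exists_hSdev_wilsonSec_of_contactRate` with the discharged contact-term rate `ContactCauchyAssemblyHolds.exists_contact_supRate_three` plugged in.

NOT IN PRINT; OUR PROOF ATTEMPT (the CT-ROUTE, CT-4a∕b∕c∕d∕e assembled for the Wilson sector; THIS file is a one-line [folklore] assembly BY NAME).  HONEST FRAMING
(cell contract, verbatim): «discharging `BetaPertH` makes Bałaban's UV stability UNCONDITIONAL — a real constructive-QFT result; it is NOT the continuum limit and NOT
the Clay problem.»  HONEST DEPENDENCY (verbatim): «continuum YM on T⁴ ⇐ BetaPertH ∧ nine spine estimates (0/9 proved); BetaPertH ⇐ (D1) ∧ (D4) ∧ CAP+tail; G-an2-4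
gates asym, D1 and NE2/3/4.»  No cited fact, no wall binder, no `def`, no `def … : Prop`, 0 sorry.  WHAT THIS IS AND IS NOT: hSdev for the Wilson lineage
`wilsonSecAt` of the COMB family `SrecAt` only; (hSall) of the full `SrecAt` needs the born sectors' rate halves (crux team: leaf-06 `BornLambdaDriftSup`, leaf-04
`BornBorderDrift…`, leaf-01 (C4)-DIFF, leaf-03 (V-C)-DIFF) through the owner's socket `SrecAtRateOfSectors.exists_hSall_SrecAt_of_sectors`; NOT the sym family
`JsB12Sym` (CT-5); NEVER «G-an2-4 closed» as (CONV-C); NOT D1, NOT `BetaPertH`, NOT continuum, NOT Clay.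
Unit `b2b-balaban-gan24-p1` (row owner G-an2-4, gen 22), 2026-08-21.
-/

noncomputable section

open Literature.MathematicalPhysics.QuantumFieldTheory.Balaban1983to89.Beta
open OneStepResolventKernel (LocStencil)
open AffineAveraging (box toSite)
open Summit.QuantumFields.BalabanUV.Beta.HessKerDressedUnits (unitS)
open Summit.QuantumFields.BalabanUV.Beta.GAN24.CombesThomas (sfStep smStep)
open Summit.QuantumFields.BalabanUV.Beta.GAN24.SrecWilsonSector (wilsonSecAt)
open Summit.QuantumFields.BalabanUV.Beta.GAN24.WilsonSectorRate (exists_hSdev_wilsonSec_of_contactRate)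
open Summit.QuantumFields.BalabanUV.Beta.GAN24.ContactCauchyAssemblyHolds (exists_contact_supRate_three)

namespace Summit.QuantumFields.BalabanUV.Beta.GAN24.WilsonSectorRateHolds

variable {Lc : ℕ} [NeZero Lc]

/-- NOT IN PRINT; OUR PROOF ATTEMPT (CT-4e for the Wilson sector, UNCONDITIONAL; [folklore] assembly).  **hSdev FOR THE CUBIC-WILSON SECTOR OF THE RECURSIVE COMB
FAMILY (E)** (`d = 3`, every `Lc ≥ 2`, pin `cE = Lc^4`): `∃ cS θS δS, 0 ≤ cS ∧ 0 ≤ θS ∧ θS < 1 ∧ 0 < δS ∧` for EVERY in-block root `rr` and ALL `k j`,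
`LocStencil (unitS (sfStep Lc (k+j)) (smStep 3 Lc (k+j)) (wilsonSecAt Lc (toSite rr) cE (k+j)) − unitS (sfStep Lc k) (smStep 3 Lc k) (wilsonSecAt Lc (toSite rr) cE k)) (cS·θS^k) δS`
— the `hW` slot of `SrecAtRateOfSectors.exists_hSall_SrecAt_of_sectors`. -/
theorem exists_hSdev_wilsonSec_three (hLc : 2 ≤ Lc) {cE : ℝ} (hcE : cE = (Lc : ℝ) ^ (3 + 1)) :
    ∃ cS θS δS : ℝ, 0 ≤ cS ∧ 0 ≤ θS ∧ θS < 1 ∧ 0 < δS ∧ ∀ (rr : Fin (3 + 1) → ℕ), rr ∈ box (3 + 1) Lc →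
      ∀ k j : ℕ, LocStencil (unitS (sfStep Lc (k + j)) (smStep 3 Lc (k + j)) (wilsonSecAt Lc (toSite rr) cE (k + j))
        - unitS (sfStep Lc k) (smStep 3 Lc k) (wilsonSecAt Lc (toSite rr) cE k)) (cS * θS ^ k) δS :=
  exists_hSdev_wilsonSec_of_contactRate hLc hcE (exists_contact_supRate_three (Lc := Lc) hLc)

end Summit.QuantumFields.BalabanUV.Beta.GAN24.WilsonSectorRateHolds

end
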